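import Literature.NumberTheory.GaloisRepresentations.ContinuousCohomologyIntInfRes
import Literature.NumberTheory.GaloisRepresentations.ContinuousCharactersAbelianization
import HarnessLib

/-!
# `H²(·, ℤ)`: the index kills the kernel of restriction, and `H²(G^ab, ℤ) ⥲ H²(G, ℤ)`

Topic `NumberTheory/GaloisRepresentations`; namespace `Literature.NumberTheory.GaloisRepresentations`.
Theorems only (no definition, no named fact).  Two consequences of `H²(G, ℤ) ≅ Hom_cont(G, ℚ/ℤ)`
(`H2IntEquivHom`) and its naturality (`ContinuousCohomologyIntInfRes.lean`):

* `nsmul_index_apply_eq_zero_of_forall_mem`, `index_nsmul_eq_zero_of_forall_mem` — a continuous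
  character vanishing on a subgroup `H` of finite index `n` satisfies `n • χ = 0` (its image is a
  quotient of `G ⧸ ker χ`, of order dividing `n`);
* **`index_nsmul_eq_zero_of_res_two_ZCoeff_eq_zero` — `res_H c = 0 ⇒ (G : H) • c = 0` in `H²(G, ℤ)`**
  for a compact subgroup `H` of finite index: the `ℤ`-coefficient, degree-`2` shadow of
  `cor ∘ res = (G : H)` (Serre, *Galois Cohomology* I §2.4 Prop. 9 and Cor.), obtained here without a
  degree-`2` corestriction;
* **`pullH_abelianizationMk_two_ZCoeff_bijective` — inflation `H²(G^ab, ℤ) → H²(G, ℤ)` is bijective**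
  (`G^ab = TopologicalAbelianization G` profinite): injective as inflation along a surjection, onto
  because every character of `G` kills `closure [G, G]` (`commutatorClosure_le_oneCocycleKer`);
  `H2IntEquivHomAbelianization_pullH_abelianizationMk` — compatibility with
  `H2IntEquivHomAbelianization : H²(G, ℤ) ≃ Hom_cont(G^ab, ℚ/ℤ)`.

Honest framing: classical; nothing here bears on abc or takes a side on [IUTchIII] Cor. 3.12.

## References
* J.-P. Serre, *Galois Cohomology* (1997), I §2.4 Prop. 9, I §2.6. [SerreGaloisCohomology1997]
* J.-P. Serre, *Local Fields* (1979), XIII §1. [SerreLocalFields1979]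
-/

noncomputable section

open CategoryTheory Function

universe u

namespace Literature.NumberTheory.GaloisRepresentations

open _root_.TopRep _root_.ContRepresentation _root_.ContinuousCohomology _root_.Topology

section Index

variable {G : Type u} [Group G] [TopologicalSpace G] [IsTopologicalGroup G]
variable {A : Type u} [AddCommGroup A] [TopologicalSpace A] [DiscreteTopology A]

omit [IsTopologicalGroup G] in
/-- **A continuous character vanishing on a subgroup of finite index `n` takes values killed by `n`.**
(`H ≤ ker χ`, so `(G : ker χ) ∣ n`, and `χ(g)` lies in the image `≅ G ⧸ ker χ`.)
[cite: SerreGaloisCohomology1997, I §2.4 Prop. 9] -/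
theorem nsmul_index_apply_eq_zero_of_forall_mem
    (χ : contOneCocycles (ContinuousRep.trivial G ℤ A).toTopRep) (H : Subgroup G) [H.FiniteIndex]
    (hχ : ∀ h ∈ H, χ.1 h = 0) (g : G) : H.index • χ.1 g = 0 := by
  let φ : G →* Multiplicative A := contOneCocycles.toMonoidHomOfTrivial χ
  have hHK : H ≤ φ.ker := fun h hh => by
    rw [MonoidHom.mem_ker, contOneCocycles.toMonoidHomOfTrivial_apply, hχ h hh]; rfl
  have hdvd : φ.ker.index ∣ H.index := Subgroup.index_dvd_of_le hHK
  -- the order of `φ g` divides `|G ⧸ ker φ| = (G : ker φ)`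
  have hcard : Nat.card φ.range = φ.ker.index :=
    (Nat.card_congr (QuotientGroup.quotientKerEquivRange φ).toEquiv).symm
  have hord : orderOf (φ g) ∣ φ.ker.index := by
    have hmem : φ g ∈ φ.range := ⟨g, rfl⟩
    have h := orderOf_dvd_natCard (⟨φ g, hmem⟩ : φ.range)
    rw [hcard, ← Subgroup.orderOf_coe] at h
    exact h
  have h2 : addOrderOf (χ.1 g) ∣ H.index := by
    rw [← orderOf_ofAdd_eq_addOrderOf]
    exact hord.trans hdvd
  exact addOrderOf_dvd_iff_nsmul_eq_zero.mp h2

omit [IsTopologicalGroup G] in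
/-- `(G : H) • χ = 0` for a continuous character `χ` vanishing on the finite-index subgroup `H`.
[cite: SerreGaloisCohomology1997, I §2.4 Prop. 9] -/
theorem index_nsmul_eq_zero_of_forall_mem
    (χ : contOneCocycles (ContinuousRep.trivial G ℤ A).toTopRep) (H : Subgroup G) [H.FiniteIndex]
    (hχ : ∀ h ∈ H, χ.1 h = 0) : H.index • χ = 0 :=
  Subtype.ext (ContinuousMap.ext fun g => nsmul_index_apply_eq_zero_of_forall_mem χ H hχ g)

variable [CompactSpace G] [T2Space G] [TotallyDisconnectedSpace G]

/-- **`res_H c = 0 ⇒ (G : H) • c = 0` in `H²(G, ℤ)`** for a compact subgroup `H` of finite index of a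
profinite group `G` (the shadow of `cor ∘ res = (G : H)`): the character of `c` vanishes on `H`
(`res_two_ZCoeff_eq_zero_iff`), hence is killed by the index.
[cite: SerreGaloisCohomology1997, I §2.4 Prop. 9] -/
theorem index_nsmul_eq_zero_of_res_two_ZCoeff_eq_zero (H : Subgroup G) [H.FiniteIndex]
    [CompactSpace H] (c : continuousCohomology 2 (ContinuousRep.trivial G ℤ ZCoeff.{u}).toTopRep)
    (hc : pullH (subgroupIncl H) (ContinuousRep.trivial G ℤ ZCoeff.{u}) 2 c = 0) :
    H.index • c = 0 := by
  apply (H2IntEquivHom G).injective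
  rw [map_nsmul, map_zero]
  exact index_nsmul_eq_zero_of_forall_mem _ H ((res_two_ZCoeff_eq_zero_iff H c).mp hc)

/-- **A class of `H²(G, ℤ)` restricting to zero on an open subgroup is torsion of order dividing the
index.** [cite: SerreGaloisCohomology1997, I §2.4 Prop. 9] -/
theorem index_nsmul_eq_zero_of_res_two_ZCoeff_eq_zero_of_isOpen (H : Subgroup G)
    (hH : IsOpen (H : Set G)) (c : continuousCohomology 2 (ContinuousRep.trivial G ℤ ZCoeff.{u}).toTopRep)
    (hc : haveI : CompactSpace H :=
        isCompact_iff_compactSpace.mp (Subgroup.isClosed_of_isOpen H hH).isCompact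
      pullH (subgroupIncl H) (ContinuousRep.trivial G ℤ ZCoeff.{u}) 2 c = 0) :
    H.index • c = 0 := by
  haveI : CompactSpace H :=
    isCompact_iff_compactSpace.mp (Subgroup.isClosed_of_isOpen H hH).isCompact
  haveI : Finite (G ⧸ H) := Subgroup.quotient_finite_of_isOpen H hH
  haveI : H.FiniteIndex := Subgroup.finiteIndex_of_finite_quotient
  exact index_nsmul_eq_zero_of_res_two_ZCoeff_eq_zero H c hc

end Index

/-! ### `H²(G^ab, ℤ) ⥲ H²(G, ℤ)` -/

section Abelianization

variable (G : Type u) [Group G] [TopologicalSpace G] [IsTopologicalGroup G] [CompactSpace G]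
  [T2Space G] [TotallyDisconnectedSpace G]
  [CompactSpace (TopologicalAbelianization G)] [T2Space (TopologicalAbelianization G)]
  [TotallyDisconnectedSpace (TopologicalAbelianization G)]

/-- **Inflation `H²(G^ab, ℤ) → H²(G, ℤ)` is bijective** (`G`, `G^ab` profinite): injective along the
surjection `G → G^ab`, surjective since every continuous character of `G` kills `closure [G, G]`.
[cite: SerreLocalFields1979, XIII §1] -/
theorem pullH_abelianizationMk_two_ZCoeff_bijective :
    Bijective (pullH (abelianizationMk G)
      (ContinuousRep.trivial (TopologicalAbelianization G) ℤ ZCoeff.{u}) 2) := by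
  refine ⟨pullH_two_ZCoeff_injective_of_surjective _ QuotientGroup.mk_surjective, fun c => ?_⟩
  obtain ⟨c₀, hc₀⟩ := (exists_inf_two_ZCoeff_eq_iff ((commutator G).topologicalClosure) c).mpr
    fun n hn => (mem_oneCocycleKer_iff _ n).mp (commutatorClosure_le_oneCocycleKer _ hn)
  exact ⟨c₀, hc₀⟩

/-- `χ_{inf c₀} = χ_{c₀} ∘ (G → G^ab)`, i.e. `H2IntEquivHom G (inf c₀)` is the image of
`H2IntEquivHom G^ab c₀` under `contOneCocyclesAbelianizationEquiv`. [cite: SerreLocalFields1979, XIII §1] -/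
theorem H2IntEquivHom_pullH_abelianizationMk
    (c₀ : continuousCohomology 2
      (ContinuousRep.trivial (TopologicalAbelianization G) ℤ ZCoeff.{u}).toTopRep) :
    H2IntEquivHom G (pullH (abelianizationMk G)
        (ContinuousRep.trivial (TopologicalAbelianization G) ℤ ZCoeff.{u}) 2 c₀) =
      contOneCocyclesAbelianizationEquiv G QModZCoeff.{u}
        (H2IntEquivHom (TopologicalAbelianization G) c₀) :=
  H2IntEquivHom_pullH _ _

/-- **`H2IntEquivHomAbelianization G (inf c₀) = H2IntEquivHom G^ab c₀`**: through the inflation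
isomorphism, `H²(G, ℤ) ≃ Hom_cont(G^ab, ℚ/ℤ)` of `ContinuousCharactersAbelianization.lean` is the
inverse Bockstein of `G^ab`. [cite: SerreLocalFields1979, XIII §1] -/
theorem H2IntEquivHomAbelianization_pullH_abelianizationMk
    (c₀ : continuousCohomology 2
      (ContinuousRep.trivial (TopologicalAbelianization G) ℤ ZCoeff.{u}).toTopRep) :
    H2IntEquivHomAbelianization G (pullH (abelianizationMk G)
        (ContinuousRep.trivial (TopologicalAbelianization G) ℤ ZCoeff.{u}) 2 c₀) =
      H2IntEquivHom (TopologicalAbelianization G) c₀ := by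
  rw [H2IntEquivHomAbelianization, LinearEquiv.trans_apply, H2IntEquivHom_pullH_abelianizationMk,
    LinearEquiv.symm_apply_apply]

end Abelianization

end Literature.NumberTheory.GaloisRepresentations

end
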